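import Summits.QuantumFields.BalabanUV.Beta.CovariantTowerLocal
import Summits.QuantumFields.BalabanUV.Beta.UnitLatticeWalkInversion

/-!
# Beta / CovariantTowerWRS — THE JUNCTION, PART 1: the inverse of the k-fold covariant tower operator Δ′ = Δ_U +
# Σ_{l≤k} a_l·G_lᵀG_l of the pv21 MODEL IS A (2.16)-CURRENCY KERNEL — d4-p3's walk-inversion engine
# (`UnitLatticeWalkInversion.walkInversion`, BY NAME) instantiated with the b05 partition of unity at scale M₀, the pv21
# Dirichlet inverses G′_z on the block hulls Ω₀(z) as local inverses (budget C_L from the gen-4 Combes–Thomas decay at ANY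
# rate κ < θ_D), the first moment K₁ of K′ = Δ′ − 1 (`CovariantTowerLocal`) and the cover number ν_k(M₀)
# (`CovariantTowerCover`): `(cmat Δ′)⁻¹ = Ptot·(1 − Rem)⁻¹`, `WRS κ dist (cmat Δ′)⁻¹ ≤ ν·C_L·(1 − (8dν/M₀)·C_L·K₁)⁻¹` —
# volume-free, every isometric transport U, FIXED rate κ < θ_D, «M₀ sufficiently large» explicit (unit
# `b2b-balaban-beta-d4-p2`, GEN 5; third module of `CovariantTowerMatrix → CovariantTowerLocal → this → CovariantTowerRowData`)

HONEST FRAMING: discharging `BetaPertH` makes Bałaban's UV stability UNCONDITIONAL — NOT the continuum limit, NOT the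
Clay problem.  HONEST DEPENDENCY (verbatim): «continuum YM on T⁴ ⇐ BetaPertH ∧ nine spine estimates (0/9 proved);
BetaPertH ⇐ (D1) ∧ (D4) ∧ CAP+tail; G-an2-4 gates asym, D1 and NE2/3/4.»  THIS MODULE DISCHARGES NOTHING of `BetaPertH`,
asserts NOTHING printed and cites nothing as a fact (ABSOLUTE RULE): [folklore] kernel theorems about the component MODEL
(pv21 `B9Thm37GlueTorusCov*`; model of [B9] = `Balaban1985BackgroundPropagators`, Commun. Math. Phys. 99 (1985) 389–434;
SHAPES modelled: (3.42) entry 1 / Thm 3.1 p. 397 in the exponentially weighted row-sum norm, (3.87)–(3.91) pp. 408–409,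
and the (2.16)-currency of [II] = `Balaban1988RG2Cluster` p. 16 in which NODE A (an4 `AnalyticWalkSum216Row*`) is written).
FOR ROW D4: the O.2(model) → NODE A junction; constants k-DEPENDENT (O.2 item (v) untouched); class unchanged; NO DATE.

CONTENT.  §1 torus data in the matrix currency (`dTorus`, `hTorus`, `ETorus`, `towerOpT`, `LTorus`) and the engine's
hypotheses (`sum_hTorus_sq`, `hTorus_supp`, `hTorus_abs`, `hTorus_lip`, `card_ETorus_le`, `Pj_ETorus`, `Pj_mul_LTorus`,
`local_inverse_LTorus` ← pv21 `towerDir_right`).  §2 `sigmaD`, `thetaD`, `localConst`, **`wrs_LTorus`** (WRS κ dist G′_z ≤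
C_L(κ) = (2/σ_D)·|Cp|·Λ_d(θ_D − κ), κ < θ_D; gen-4 `dirInv_entry_decay_tower_torus` + b04 `torusSum_le`).  §3
**`walkInversion_tower_torus`**, `wrsSmallness`, `wrsConst` (the real-entry form and `cmat Δ′⁻¹ = (cmat Δ′)⁻¹` are in the
sibling `CovariantTowerRowData`).  NOT BetaPertH, NOT continuum, NOT Clay.
-/

namespace Summit.QuantumFields.BalabanUV.Beta.CovariantTowerWRS

open Finset
open Literature.MathematicalPhysics.QuantumFieldTheory.Balaban1983to89
open B9Thm37Sum B9Thm37Glue B9Thm37GluePU B9Thm37GlueTorusInv B9Thm37GlueTorusCov B9Thm37GlueTorusCovComp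
open B9Thm37GlueTorusCovPoinc (tdepth_le card_block_le)
open B9Thm37GlueTorusCovLevels B9Thm37GlueTorusCovTower B9Thm37GlueTorusCovTowerDir
open B9Thm37GlueTorusCovTowerPU (omegaBall omegaBall_zero_or_one omegaBall_eq_one)
open B13PerturbativeStep (WRS wrs WeightHyp)
open Summit.QuantumFields.BalabanUV.Beta.CovariantTowerL2
open Summit.QuantumFields.BalabanUV.Beta.CovariantTowerDecay (kappaTower)
open Summit.QuantumFields.BalabanUV.Beta.CovariantTowerDecayTorus (thetaTower thetaTower_pos kappa_thetaTower_le
  thetaTowerTorus dirInv_entry_decay_tower_torus)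
open Summit.QuantumFields.BalabanUV.Beta.CovariantTowerParametrix (hSU_eq_zero_of_chiBall_eq_zero)
open Summit.QuantumFields.BalabanUV.Beta.CovariantTowerLocality (chiBall_le_omegaBall)
open Summit.QuantumFields.BalabanUV.Beta.CovariantTowerCover (coverNumber coverNumber_nonneg sum_omegaBall_le)
open Summit.QuantumFields.BalabanUV.Beta.CovariantTowerMatrix
open Summit.QuantumFields.BalabanUV.Beta.CovariantTowerLocal
open Summit.QuantumFields.BalabanUV.Beta.UnitLatticeWalkInversion (Hd Pj Ptot Rem walkInversion)
open B5TorusCover (UT Ctr ctrU)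
open B5SmoothPartition (hSU hSU_lipschitz sum_hSU_sq)

noncomputable section

variable {d : ℕ} {N : Fin d → ℕ} [∀ i, NeZero (N i)] [NeZero d]

/-! ## §1  The torus data in the matrix currency -/

section DataPlain

variable {Cp : Type}

omit [NeZero d] in
/-- MODEL bookkeeping: the pseudo-metric on sites × components — the torus distance of the sites. [folklore] -/
def dTorus (N : Fin d → ℕ) [∀ i, NeZero (N i)] (Cp : Type) : UT N × Cp → UT N × Cp → ℝ := fun p q => dist p.1 q.1

omit [NeZero d] in
/-- Unfolding of `dTorus`. [folklore] -/
@[simp] theorem dTorus_apply (p q : UT N × Cp) : dTorus N Cp p q = dist p.1 q.1 := rfl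

omit [NeZero d] in
/-- `dTorus` is an admissible weight for every κ ≥ 0 (a pseudo-metric). [folklore] -/
theorem weightHyp_dTorus {κ : ℝ} (hκ : 0 ≤ κ) : WeightHyp κ (dTorus N Cp) where
  κ_nonneg := hκ
  zero p := dist_self p.1
  nonneg _ _ := dist_nonneg
  tri p q r := dist_triangle p.1 q.1 r.1

omit [NeZero d] in
/-- MODEL bookkeeping: the b05 partition functions read on sites × components. [folklore] -/
def hTorus (N : Fin d → ℕ) [∀ i, NeZero (N i)] (Cp : Type) (M₀ : ℕ) : Ctr N M₀ → UT N × Cp → ℝ :=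
  fun z p => hSU N M₀ z p.1

omit [NeZero d] in
/-- Unfolding of `hTorus`. [folklore] -/
@[simp] theorem hTorus_apply (M₀ : ℕ) (z : Ctr N M₀) (p : UT N × Cp) : hTorus N Cp M₀ z p = hSU N M₀ z p.1 := rfl

omit [NeZero d] in
/-- (h1) Σ_z h_z² = 1. [folklore] -/
theorem sum_hTorus_sq {M₀ : ℕ} (hM₀ : 1 ≤ M₀) (hdiv₀ : ∀ i, M₀ ∣ N i) (h2N : ∀ i, 2 * M₀ ≤ N i) (p : UT N × Cp) :
    ∑ z : Ctr N M₀, hTorus N Cp M₀ z p ^ 2 = 1 :=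
  sum_hSU_sq N hM₀ hdiv₀ h2N p.1

/-- Ω₀(z) is {0,1}-valued on sites × components. [folklore] -/
theorem omega01 {M : ℕ → ℕ} (hM : ∀ j, 1 ≤ M j) (hdiv : ∀ j i, M j ∣ N i) (k M₀ : ℕ) (z : Ctr N M₀)
    (p : UT N × Cp) : (omegaBall hM hdiv k M₀ z ∘ Prod.fst) p = 0 ∨ (omegaBall hM hdiv k M₀ z ∘ Prod.fst) p = 1 :=
  omegaBall_zero_or_one hM hdiv k M₀ z p.1

omit [NeZero d] in
/-- (h3) |h_z| ≤ 1. [folklore] -/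
theorem hTorus_abs (M₀ : ℕ) (z : Ctr N M₀) (p : UT N × Cp) : |hTorus N Cp M₀ z p| ≤ 1 := hh_torus M₀ z p.1

/-- (h4) h_z is Lipschitz at scale M₀/(4d). [folklore] -/
theorem hTorus_lip {M₀ : ℕ} (hM₀ : 1 ≤ M₀) (z : Ctr N M₀) (p q : UT N × Cp) :
    |hTorus N Cp M₀ z p - hTorus N Cp M₀ z q| ≤ dTorus N Cp p q / ((M₀ : ℝ) / (4 * d)) := by
  have hd0 : (0 : ℝ) < d := by exact_mod_cast Nat.pos_of_ne_zero (NeZero.ne d)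
  have hM0 : (0 : ℝ) < M₀ := by exact_mod_cast hM₀
  rw [hTorus_apply, hTorus_apply, dTorus_apply]
  calc |hSU N M₀ z p.1 - hSU N M₀ z q.1| ≤ 4 * d / M₀ * dist p.1 q.1 := hSU_lipschitz N hM₀ z p.1 q.1
    _ = dist p.1 q.1 / ((M₀ : ℝ) / (4 * d)) := by field_simp

end DataPlain

section DataFin

variable {Cp : Type} [Fintype Cp]

/-- MODEL bookkeeping: the block hulls Ω₀(z) of the (M₀ + 1)-balls as finsets of sites × components. [folklore] -/
def ETorus {M : ℕ → ℕ} (hM : ∀ j, 1 ≤ M j) (hdiv : ∀ j i, M j ∣ N i) (k M₀ : ℕ) (Cp : Type) [Fintype Cp] :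
    Ctr N M₀ → Finset (UT N × Cp) :=
  fun z => univ.filter fun p => omegaBall hM hdiv k M₀ z p.1 = 1

/-- Membership in `ETorus`. [folklore] -/
theorem mem_ETorus {M : ℕ → ℕ} (hM : ∀ j, 1 ≤ M j) (hdiv : ∀ j i, M j ∣ N i) (k M₀ : ℕ) (z : Ctr N M₀)
    (p : UT N × Cp) : p ∈ ETorus hM hdiv k M₀ Cp z ↔ omegaBall hM hdiv k M₀ z p.1 = 1 := by
  simp [ETorus]

/-- (h2) h_z is supported in Ω₀(z). [folklore] -/
theorem hTorus_supp {M : ℕ → ℕ} (hM : ∀ j, 1 ≤ M j) (hdiv : ∀ j i, M j ∣ N i) (k : ℕ) {M₀ : ℕ} (hM₀ : 1 ≤ M₀)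
    (z : Ctr N M₀) (p : UT N × Cp) (hp : p ∉ ETorus hM hdiv k M₀ Cp z) : hTorus N Cp M₀ z p = 0 := by
  rw [mem_ETorus] at hp
  have h0 : omegaBall hM hdiv k M₀ z p.1 = 0 := by
    rcases omegaBall_zero_or_one hM hdiv k M₀ z p.1 with h | h
    · exact h
    · exact absurd h hp
  have hle := chiBall_le_omegaBall hM hdiv k M₀ z p.1
  rw [h0] at hle
  have hχ : chiBall N M₀ z p.1 = 0 := by
    rcases chiBall_zero_or_one M₀ z p.1 with h | h
    · exact h
    · rw [h] at hle; exact absurd hle (by norm_num)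
  exact hSU_eq_zero_of_chiBall_eq_zero hM₀ z p.1 hχ

end DataFin

section DataDec

variable {Cp : Type} [Fintype Cp] [DecidableEq Cp]

/-- MODEL bookkeeping: the tower operator with BLOCK weights w_l∘towerBlk_l (the regime of pv21's Dirichlet package).
[folklore] -/
def towerOpT {M : ℕ → ℕ} (hM : ∀ j, 1 ≤ M j) (hdiv : ∀ j i, M j ∣ N i) (c : UT N × Fin d → ℝ)
    (Rm : UT N × Fin d → Cp → Cp → ℝ) (k : ℕ) (w : Fin (k + 1) → UT N → ℝ) (a : Fin (k + 1) → ℝ) :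
    Module.End ℝ (UT N × Cp → ℝ) :=
  towerOp (torusTower hM hdiv) Rm c k (fun l x => w l (towerBlk (torusTower hM hdiv) (l : ℕ) x)) a

/-- MODEL bookkeeping: the local inverses — the complex matrices of the Dirichlet inverses G′_z on Ω₀(z). [folklore] -/
def LTorus {M : ℕ → ℕ} (hM : ∀ j, 1 ≤ M j) (hdiv : ∀ j i, M j ∣ N i) (c : UT N × Fin d → ℝ)
    (Rm : UT N × Fin d → Cp → Cp → ℝ) (k : ℕ) (w : Fin (k + 1) → UT N → ℝ) (a : Fin (k + 1) → ℝ) (M₀ : ℕ) :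
    Ctr N M₀ → Matrix (UT N × Cp) (UT N × Cp) ℂ :=
  fun z => cmat (dirInv (towerOpT hM hdiv c Rm k w a) (omegaBall hM hdiv k M₀ z ∘ Prod.fst))

/-- (h5) every point lies in at most ν_k(M₀) of the hulls Ω₀(z). [folklore] -/
theorem card_ETorus_le {M : ℕ → ℕ} (hM : ∀ j, 1 ≤ M j) (hdiv : ∀ j i, M j ∣ N i) (k : ℕ) {M₀ : ℕ} (hM₀ : 1 ≤ M₀)
    (p : UT N × Cp) :
    ((univ.filter fun z : Ctr N M₀ => p ∈ ETorus hM hdiv k M₀ Cp z).card : ℝ) ≤ coverNumber d M k M₀ := by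
  have hsum : ((univ.filter fun z : Ctr N M₀ => p ∈ ETorus hM hdiv k M₀ Cp z).card : ℝ) =
      ∑ z : Ctr N M₀, omegaBall hM hdiv k M₀ z p.1 := by
    rw [Finset.card_eq_sum_ones, Nat.cast_sum, Finset.sum_filter]
    refine Finset.sum_congr rfl fun z _ => ?_
    by_cases hp : p ∈ ETorus hM hdiv k M₀ Cp z
    · rw [if_pos hp, (mem_ETorus hM hdiv k M₀ z p).1 hp]; simp
    · rw [if_neg hp]
      rcases omegaBall_zero_or_one hM hdiv k M₀ z p.1 with h | h
      · rw [h]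
      · exact absurd ((mem_ETorus hM hdiv k M₀ z p).2 h) hp
  rw [hsum]
  exact sum_omegaBall_le hM hdiv k hM₀ p.1

/-- The cube projection of the engine is the matrix of M_{Ω₀(z)}. [folklore] -/
theorem Pj_ETorus {M : ℕ → ℕ} (hM : ∀ j, 1 ≤ M j) (hdiv : ∀ j i, M j ∣ N i) (k M₀ : ℕ) (z : Ctr N M₀) :
    Pj (ETorus hM hdiv k M₀ Cp) z = cmat (mulOp (omegaBall hM hdiv k M₀ z ∘ Prod.fst)) := by
  rw [Pj, cmat_mulOp]
  congr 1
  funext p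
  rw [Function.comp_apply]
  by_cases hp : p ∈ ETorus hM hdiv k M₀ Cp z
  · rw [if_pos hp, (mem_ETorus hM hdiv k M₀ z p).1 hp]; simp
  · rw [if_neg hp]
    rcases omegaBall_zero_or_one hM hdiv k M₀ z p.1 with h | h
    · rw [h]; simp
    · exact absurd ((mem_ETorus hM hdiv k M₀ z p).2 h) hp

/-- (h6) P_z·L_z = L_z (G′_z lives on Ω₀(z)). [folklore] -/
theorem Pj_mul_LTorus {M : ℕ → ℕ} (hM : ∀ j, 1 ≤ M j) (hdiv : ∀ j i, M j ∣ N i) (c : UT N × Fin d → ℝ)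
    (Rm : UT N × Fin d → Cp → Cp → ℝ) (k : ℕ) (w : Fin (k + 1) → UT N → ℝ) (a : Fin (k + 1) → ℝ) (M₀ : ℕ)
    (z : Ctr N M₀) :
    Pj (ETorus hM hdiv k M₀ Cp) z * LTorus hM hdiv c Rm k w a M₀ z = LTorus hM hdiv c Rm k w a M₀ z := by
  rw [Pj_ETorus, LTorus, ← cmat_mul]
  congr 1
  rw [dirInv, ← mul_assoc, ← mul_assoc, mulOp_idem (omega01 hM hdiv k M₀ z)]

/-- (h7) P_z·Δ′·P_z·L_z = P_z (pv21 `towerDir_right`: G′_z inverts Ω₀Δ′Ω₀ on Ω₀; the top-to-bottom cover of the levels).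
[folklore] -/
theorem local_inverse_LTorus {M : ℕ → ℕ} (hM : ∀ j, 1 ≤ M j) (hdiv : ∀ j i, M j ∣ N i) (c : UT N × Fin d → ℝ)
    {cmin : ℝ} (hcmin : 0 < cmin) (hc : ∀ b, cmin ≤ |c b|) (Rm : UT N × Fin d → Cp → Cp → ℝ)
    (hRm : ∀ b i j, ∑ k, Rm b k i * Rm b k j = if i = j then (1 : ℝ) else 0) (k : ℕ)
    (w : Fin (k + 1) → UT N → ℝ) {a : Fin (k + 1) → ℝ} (ha : ∀ l, 0 ≤ a l) {amin wmin : ℝ} (hamin : 0 < amin)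
    (hwmin : 0 < wmin)
    (hcov : ∀ x, ∃ l : Fin (k + 1), amin ≤ a l ∧ wmin ≤ |w l (towerBlk (torusTower hM hdiv) (l : ℕ) x)|)
    (M₀ : ℕ) (z : Ctr N M₀) :
    Pj (ETorus hM hdiv k M₀ Cp) z * (1 + (cmat (towerOpT hM hdiv c Rm k w a) - 1)) * Pj (ETorus hM hdiv k M₀ Cp) z *
        LTorus hM hdiv c Rm k w a M₀ z = Pj (ETorus hM hdiv k M₀ Cp) z := by
  rw [add_sub_cancel, Pj_ETorus, LTorus, ← cmat_mul, ← cmat_mul, ← cmat_mul]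
  congr 1
  exact towerDir_right (torusTower hM hdiv) Rm hRm hcmin hc (fun j x => tdepth_le (hM j) x)
    (fun j β => card_block_le (hM j) (hdiv j) β) k w ha hamin hwmin (omega01 hM hdiv k M₀ z)
    (fun x _ _ => hcov x)

end DataDec

/-! ## §2  The local budget C_L from the Combes–Thomas decay of the Dirichlet inverses -/

section Budget

variable {Cp : Type} [Fintype Cp] [DecidableEq Cp]

/-- MODEL bookkeeping: the Dirichlet coercivity constant σ_D = min(σ_k, 1). [folklore] -/
def sigmaD (d : ℕ) (M : ℕ → ℕ) (amin wmin cmin : ℝ) (k : ℕ) : ℝ := min (sigmaTowerTorus d M amin wmin cmin k) 1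

/-- σ_D > 0. [folklore] -/
theorem sigmaD_pos (d : ℕ) (M : ℕ → ℕ) {amin wmin : ℝ} (cmin : ℝ) (k : ℕ) (hamin : 0 < amin) (hwmin : 0 < wmin) :
    0 < sigmaD d M amin wmin cmin k :=
  lt_min (sigmaTowerTorus_pos d M cmin k hamin hwmin) zero_lt_one

/-- MODEL bookkeeping: **the Dirichlet decay rate** θ_D = `thetaTowerTorus d M σ_D c_max w_max k a` (d, M, k, a, c, w only).
[folklore] -/
def thetaD (d : ℕ) (M : ℕ → ℕ) (amin wmin cmin cmax wmax : ℝ) (k : ℕ) (a : Fin (k + 1) → ℝ) : ℝ :=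
  thetaTowerTorus d M (sigmaD d M amin wmin cmin k) cmax wmax k a

/-- θ_D > 0. [folklore] -/
theorem thetaD_pos (d : ℕ) (M : ℕ → ℕ) {amin wmin : ℝ} (cmin cmax wmax : ℝ) (k : ℕ) {a : Fin (k + 1) → ℝ}
    (ha : ∀ l, 0 ≤ a l) (hamin : 0 < amin) (hwmin : 0 < wmin) : 0 < thetaD d M amin wmin cmin cmax wmax k a :=
  thetaTower_pos (sigmaD_pos d M cmin k hamin hwmin) cmax wmax d _ _ k ha

/-- MODEL bookkeeping: **the local budget** C_L(κ) = (2/σ_D)·(|Cp|·Λ_d(θ_D − κ)), Λ_d = b04's `latticeConst`. [folklore] -/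
def localConst (d : ℕ) (M : ℕ → ℕ) (amin wmin cmin cmax wmax : ℝ) (k : ℕ) (a : Fin (k + 1) → ℝ) (nC : ℕ)
    (κ : ℝ) : ℝ :=
  2 / sigmaD d M amin wmin cmin k *
    ((nC : ℝ) * B4Sect5Proof.latticeConst d (thetaD d M amin wmin cmin cmax wmax k a - κ))

/-- C_L ≥ 0. [folklore] -/
theorem localConst_nonneg (d : ℕ) (M : ℕ → ℕ) {amin wmin : ℝ} (cmin cmax wmax : ℝ) (k : ℕ) (a : Fin (k + 1) → ℝ)
    (nC : ℕ) {κ : ℝ} (hκ : κ ≤ thetaD d M amin wmin cmin cmax wmax k a) (hamin : 0 < amin) (hwmin : 0 < wmin) :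
    0 ≤ localConst d M amin wmin cmin cmax wmax k a nC κ := by
  unfold localConst
  have h1 := sigmaD_pos d M cmin k hamin hwmin
  have h2 := B4Sect5Proof.latticeConst_nonneg d (sub_nonneg.mpr hκ)
  positivity

/-- **(h8) THE LOCAL INVERSES ARE (2.16)-CURRENCY KERNELS WITH A VOLUME-FREE, U-FREE, M₀-FREE BUDGET**:
WRS κ dist G′_z ≤ C_L(κ) for every 0 ≤ κ < θ_D, every centre z, every torus, every isometric transport. [folklore] -/
theorem wrs_LTorus {M : ℕ → ℕ} (hM : ∀ j, 1 ≤ M j) (hdiv : ∀ j i, M j ∣ N i) (c : UT N × Fin d → ℝ)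
    {cmin cmax : ℝ} (hcmin : 0 < cmin) (hc : ∀ b, cmin ≤ |c b|) (hc' : ∀ b, |c b| ≤ cmax)
    (Rm : UT N × Fin d → Cp → Cp → ℝ) (hRm : ∀ b i j, ∑ k, Rm b k i * Rm b k j = if i = j then (1 : ℝ) else 0)
    (k : ℕ) (w : Fin (k + 1) → UT N → ℝ) {wmax : ℝ} (hw' : ∀ l y, |w l y| ≤ wmax) {a : Fin (k + 1) → ℝ}
    (ha : ∀ l, 0 ≤ a l) {amin wmin : ℝ} (hamin : 0 < amin) (hwmin : 0 < wmin)
    (hcov : ∀ x, ∃ l : Fin (k + 1), amin ≤ a l ∧ wmin ≤ |w l (towerBlk (torusTower hM hdiv) (l : ℕ) x)|)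
    {κ : ℝ} (hκ : κ < thetaD d M amin wmin cmin cmax wmax k a) (M₀ : ℕ) (z : Ctr N M₀) :
    WRS κ (dTorus N Cp) (LTorus hM hdiv c Rm k w a M₀ z)
      (localConst d M amin wmin cmin cmax wmax k a (Fintype.card Cp) κ) := by
  set σ := sigmaD d M amin wmin cmin k with hσdef
  set θ := thetaD d M amin wmin cmin cmax wmax k a with hθdef
  have hσ0 : 0 < σ := sigmaD_pos d M cmin k hamin hwmin
  have hθ0 : 0 < θ := thetaD_pos d M cmin cmax wmax k ha hamin hwmin
  have hA : 0 ≤ 2 / σ := div_nonneg (by norm_num) hσ0.le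
  have hμ : 0 < θ - κ := sub_pos.mpr hκ
  refine wrs_cmat_of_real fun p => ?_
  -- entrywise decay of G′_z
  have hdec : ∀ q : UT N × Cp,
      |dirInv (towerOpT hM hdiv c Rm k w a) (omegaBall hM hdiv k M₀ z ∘ Prod.fst) (Pi.single q 1) p| ≤
        2 / σ * Real.exp (-(θ * dist q.1 p.1)) := by
    intro q
    have h := dirInv_entry_decay_tower_torus hM hdiv c hcmin hc hc' Rm hRm k w hw' ha hamin hwmin
      (omega01 hM hdiv k M₀ z) (fun x _ _ => hcov x) (thetaTower_pos hσ0 cmax wmax d _ _ k ha).le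
      (kappa_thetaTower_le hσ0 cmax wmax d _ _ k ha) q p
    simpa [towerOpT, hσdef, sigmaD, hθdef, thetaD, thetaTowerTorus] using h
  calc ∑ q, |dirInv (towerOpT hM hdiv c Rm k w a) (omegaBall hM hdiv k M₀ z ∘ Prod.fst) (Pi.single q 1) p| *
          Real.exp (κ * dTorus N Cp p q)
      ≤ ∑ q : UT N × Cp, 2 / σ * Real.exp (-((θ - κ) * dist p.1 q.1)) := by
        refine Finset.sum_le_sum fun q _ => ?_
        rw [dTorus_apply]
        calc |dirInv (towerOpT hM hdiv c Rm k w a) (omegaBall hM hdiv k M₀ z ∘ Prod.fst) (Pi.single q 1) p| *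
              Real.exp (κ * dist p.1 q.1)
            ≤ 2 / σ * Real.exp (-(θ * dist q.1 p.1)) * Real.exp (κ * dist p.1 q.1) :=
              mul_le_mul_of_nonneg_right (hdec q) (Real.exp_pos _).le
          _ = 2 / σ * Real.exp (-((θ - κ) * dist p.1 q.1)) := by
              rw [mul_assoc, ← Real.exp_add, dist_comm q.1 p.1]; ring_nf
    _ = 2 / σ * ∑ y : UT N, ∑ _j : Cp, Real.exp (-((θ - κ) * dist p.1 y)) := by
        rw [Finset.mul_sum, Fintype.sum_prod_type]
        simp only [Finset.mul_sum]
    _ = 2 / σ * ((Fintype.card Cp : ℝ) * ∑ y : UT N, Real.exp (-((θ - κ) * dist p.1 y))) := by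
        congr 1
        rw [Finset.mul_sum]
        exact Finset.sum_congr rfl fun y _ => by rw [Finset.sum_const, Finset.card_univ, nsmul_eq_mul]
    _ ≤ 2 / σ * ((Fintype.card Cp : ℝ) * B4Sect5Proof.latticeConst d (θ - κ)) := by
        refine mul_le_mul_of_nonneg_left (mul_le_mul_of_nonneg_left ?_ (Nat.cast_nonneg _)) hA
        exact B4Sect5Torus.torusSum_le d (UT.one_le N) hμ (UT.toSite N p.1)
    _ = localConst d M amin wmin cmin cmax wmax k a (Fintype.card Cp) κ := by
        rw [localConst, ← hσdef, ← hθdef]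

end Budget

/-! ## §3  The walk inversion of the tower operator in the (2.16)-currency -/

section Inversion

variable {Cp : Type} [Fintype Cp] [DecidableEq Cp]

/-- MODEL bookkeeping: **the smallness parameter of the walk inversion**, ρ = (2ν/(M₀/4d))·C_L(κ)·K₁(κ). [folklore] -/
def wrsSmallness (d : ℕ) (M : ℕ → ℕ) (amin wmin cmin cmax wmax : ℝ) (k : ℕ) (a : Fin (k + 1) → ℝ) (nC : ℕ)
    (M₀ : ℕ) (κ : ℝ) : ℝ :=
  2 * coverNumber d M k M₀ / ((M₀ : ℝ) / (4 * d)) * localConst d M amin wmin cmin cmax wmax k a nC κ *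
    momentConst d M cmax wmax k a nC κ

/-- MODEL bookkeeping: **the (2.16)-currency constant of Δ′⁻¹**, ν·C_L·(1 − ρ)⁻¹. [folklore] -/
def wrsConst (d : ℕ) (M : ℕ → ℕ) (amin wmin cmin cmax wmax : ℝ) (k : ℕ) (a : Fin (k + 1) → ℝ) (nC : ℕ) (M₀ : ℕ)
    (κ : ℝ) : ℝ :=
  coverNumber d M k M₀ * localConst d M amin wmin cmin cmax wmax k a nC κ *
    (1 - wrsSmallness d M amin wmin cmin cmax wmax k a nC M₀ κ)⁻¹

/-- **THE WALK INVERSION OF THE k-FOLD COVARIANT TOWER OPERATOR IN THE (2.16)-CURRENCY** (d4-p3's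
`UnitLatticeWalkInversion.walkInversion` BY NAME on the torus data of §1–§2): for 0 ≤ κ < θ_D and
ρ = `wrsSmallness … M₀ κ` < 1 («M₀ sufficiently large», every other letter fixed),
`cmat Δ′` is a unit, `(cmat Δ′)⁻¹ = Ptot·(1 − Rem)⁻¹` with the partition h_z and the local inverses G′_z, and
`WRS κ dist (cmat Δ′)⁻¹ ≤ ν·C_L·(1 − ρ)⁻¹` — every torus (M_j ∣ N_i, M₀ ∣ N_i, 2M₀ ≤ N_i), every isometric transport.
[folklore] -/
theorem walkInversion_tower_torus {M : ℕ → ℕ} (hM : ∀ j, 1 ≤ M j) (hdiv : ∀ j i, M j ∣ N i)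
    (c : UT N × Fin d → ℝ) {cmin cmax : ℝ} (hcmin : 0 < cmin) (hc : ∀ b, cmin ≤ |c b|) (hc' : ∀ b, |c b| ≤ cmax)
    (Rm : UT N × Fin d → Cp → Cp → ℝ) (hRm : ∀ b i j, ∑ k, Rm b k i * Rm b k j = if i = j then (1 : ℝ) else 0)
    (k : ℕ) (w : Fin (k + 1) → UT N → ℝ) {wmax : ℝ} (hw' : ∀ l y, |w l y| ≤ wmax) {a : Fin (k + 1) → ℝ}
    (ha : ∀ l, 0 ≤ a l) {amin wmin : ℝ} (hamin : 0 < amin) (hwmin : 0 < wmin)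
    (hcov : ∀ x, ∃ l : Fin (k + 1), amin ≤ a l ∧ wmin ≤ |w l (towerBlk (torusTower hM hdiv) (l : ℕ) x)|)
    {M₀ : ℕ} (hM₀ : 1 ≤ M₀) (hdiv₀ : ∀ i, M₀ ∣ N i) (h2N : ∀ i, 2 * M₀ ≤ N i)
    {κ : ℝ} (hκ0 : 0 ≤ κ) (hκ : κ < thetaD d M amin wmin cmin cmax wmax k a)
    (hρ : wrsSmallness d M amin wmin cmin cmax wmax k a (Fintype.card Cp) M₀ κ < 1) :
    IsUnit (cmat (towerOpT hM hdiv c Rm k w a)) ∧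
      (cmat (towerOpT hM hdiv c Rm k w a))⁻¹ =
        Ptot (hTorus N Cp M₀) (LTorus hM hdiv c Rm k w a M₀) *
          (1 - Rem (hTorus N Cp M₀) (cmat (towerOpT hM hdiv c Rm k w a) - 1) (LTorus hM hdiv c Rm k w a M₀))⁻¹ ∧
      WRS κ (dTorus N Cp) (cmat (towerOpT hM hdiv c Rm k w a))⁻¹
        (wrsConst d M amin wmin cmin cmax wmax k a (Fintype.card Cp) M₀ κ) := by
  have hd0 : (0 : ℝ) < d := by exact_mod_cast Nat.pos_of_ne_zero (NeZero.ne d)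
  have hM0 : (0 : ℝ) < M₀ := by exact_mod_cast hM₀
  have hcmax : 0 ≤ cmax := le_trans (le_trans hcmin.le (hc (ctrU N M₀ (fun _ => ⟨0, B5TorusCover.one_le_nC _ _⟩),
    ⟨0, Nat.pos_of_ne_zero (NeZero.ne d)⟩))) (hc' _)
  have hwmax : 0 ≤ wmax := (abs_nonneg _).trans (hw' 0 (ctrU N M₀ fun _ => ⟨0, B5TorusCover.one_le_nC _ _⟩))
  have hW : ∀ (l : Fin (k + 1)) (x : UT N), |w l (towerBlk (torusTower hM hdiv) (l : ℕ) x)| ≤ wmax :=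
    fun l x => hw' l _
  have h := walkInversion (weightHyp_dTorus (N := N) (Cp := Cp) hκ0) (cmat (towerOpT hM hdiv c Rm k w a) - 1)
    (hTorus N Cp M₀) (ETorus hM hdiv k M₀ Cp) (LTorus hM hdiv c Rm k w a M₀)
    (sum_hTorus_sq hM₀ hdiv₀ h2N) (fun z p hp => hTorus_supp hM hdiv k hM₀ z p hp) (hTorus_abs M₀)
    (M := (M₀ : ℝ) / (4 * d)) (N := coverNumber d M k M₀)
    (C_L := localConst d M amin wmin cmin cmax wmax k a (Fintype.card Cp) κ)
    (K₁ := momentConst d M cmax wmax k a (Fintype.card Cp) κ)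
    (by positivity) (fun z p q => hTorus_lip hM₀ z p q) (fun p => card_ETorus_le hM hdiv k hM₀ p)
    (localConst_nonneg d M cmin cmax wmax k a _ hκ.le hamin hwmin)
    (fun z => wrs_LTorus hM hdiv c hcmin hc hc' Rm hRm k w hw' ha hamin hwmin hcov hκ M₀ z)
    (fun z => Pj_mul_LTorus hM hdiv c Rm k w a M₀ z)
    (fun z => local_inverse_LTorus hM hdiv c hcmin hc Rm hRm k w ha hamin hwmin hcov M₀ z)
    (fun p => by
      simpa [dTorus_apply, towerOpT] using
        firstMoment_towerOp_le hM hdiv c hcmax hc' Rm hRm k (W := fun l x => w l (towerBlk (torusTower hM hdiv) (l : ℕ) x))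
          hwmax hW ha hκ0 p)
    (by simpa [wrsSmallness] using hρ)
  rw [add_sub_cancel] at h
  refine ⟨h.1, h.2.1, ?_⟩
  simpa [wrsConst, wrsSmallness] using h.2.2

end Inversion

end

end Summit.QuantumFields.BalabanUV.Beta.CovariantTowerWRS
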